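import Mathlib
import Literature.AlgebraicGeometry.Resolution.CompletedChainDescentTools
import Literature.AlgebraicGeometry.Resolution.CompletedChainNonRationalStep
import Literature.AlgebraicGeometry.Resolution.NoFormalPermissibleSurface
import Literature.AlgebraicGeometry.Resolution.CompletedChainShearStep
import Literature.AlgebraicGeometry.Resolution.CompletedChainPolygonLaws
import Literature.AlgebraicGeometry.Resolution.PointStepChartExclusion
import Literature.AlgebraicGeometry.Resolution.FullChainContractGlue
import Literature.AlgebraicGeometry.Resolution.PreparedUpToSwap
import Literature.AlgebraicGeometry.Resolution.PolygonSymmetry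
import Literature.AlgebraicGeometry.Resolution.AdaptedTauOneForms
import Literature.AlgebraicGeometry.Resolution.ExcellentRings
import HarnessLib

/-!
# The point level of the descent down the completed chain (`τ = 1` endgame, OPTION R, brick R-5: S-step-pt)

Topic: `Literature/AlgebraicGeometry/Resolution`. V. Cossart, U. Jannsen, S. Saito, LNM 2270 (2020), proof of
Thm. 13.7 (pp. 157–158), Prop. 13.5, Lemma 13.2–13.4, Lemma 13.6, Thm. 14.4 [cite: CossartJannsenSaito2020, Thm. 13.7];
V. Cossart, O. Piltant, J. Algebra 320 (2008), Lemma 4.5 (2) [cite: CossartPiltant2008, Lemma 4.5].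

OURS (one POINT level of the completed-chain descent `CompletedChainDescent`, CONTRACT v3′ frame): from a totally
prepared adapted label `x = (ŷ, ι p₁, ι p₂)` of `R̂` with exact algebraic slots in the fixed print orientation,
a flag `e` (`span {p_e} = span {u_n}`), and the clauses of a point level `n` (the trichotomy `hpt_cases`, the
exceptional parameter `u_{n+1}` with `𝔪_n R_{n+1} = (u_{n+1})`, the weak transform, quasi-isolation at `n`
and `n + 1`, the next centre `hPsucc_pt`), a label of the same kind at level `n + 1` with
`2β′ + [e′ = 2] ≤ 2β + [e = 2]`, equality forcing a GOOD step (`k(x′) = k(x)`, `(u_{n+1}) = (φ u_n)`).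
The trichotomy is read on the algebraic approximation `(l, p₁, p₂)` of the label
(`exists_adapted_label_of_completion`): (i) rational point of the `p₁`-chart — shear by `a` (R-4
`completedChain_shear`) then `completedChain_point_step` (`hpoint` by `hpoint_of_pointCases`), `β′ ≤ β`
(`completedChain_pointStep_laws`), flag′ = 1; (iii) non-rational — `completedChain_nonRational_step` (`hnonrat` by
`hnonrat_of_pointCases`, `α < L` by B1 `isolated_map_adicCompletion` + `pts_nonempty_and_alphaS_lt_of_isolated`,
`hNS′` by R-3b `not_map_adicCompletion_le_span_pow`), `β′ < β`, flag′ = 1; (i′) origin of the `p₂`-chart — swap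
(`preparedUpTo_forall_comp_σ₁₂`) then `completedChain_point_step` in the `p₂`-frame, swap back,
`β′ + L ≤ α + β < β + L` (`completedChain_pointStepTwo_laws`), flag′ = 2. The new third slot is exact algebraic by
Krull's intersection theorem applied to the bricks' approximation clauses. F-71 / T1 NOT proved; no summit
statement is proved; resolution in dimension `≥ 4` / positive characteristic is NOT proved. AI-written; weaker
than expert review.
-/

noncomputable section

open IsLocalRing MvPolynomial

namespace Literature.AlgebraicGeometry.Resolution

universe u

/-! ## Small tools -/

section Tools

/-- Krull's intersection theorem, pointwise: elements congruent modulo every power of `𝔪` are equal.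
[cite: Matsumura1987, Thm. 8.10] -/
theorem eq_of_forall_sub_mem_pow_maximalIdeal {A : Type u} [CommRing A] [IsNoetherianRing A] [IsLocalRing A]
    {a b : A} (h : ∀ k, a - b ∈ maximalIdeal A ^ k) : a = b := by
  have hmem : a - b ∈ ⨅ k, maximalIdeal A ^ k := Ideal.mem_iInf.mpr h
  rw [Ideal.iInf_pow_eq_bot_of_isLocalRing _ (IsLocalRing.maximalIdeal.isMaximal A).ne_top] at hmem
  exact sub_eq_zero.mp hmem

/-- `{a, b, c} = {a, c, b}` under `Ideal.span`. [cite: Matsumura1987, §1 (p. 2)] -/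
theorem span_triple_swap23 {S : Type u} [CommRing S] (a b c : S) :
    Ideal.span ({a, b, c} : Set S) = Ideal.span {a, c, b} := by
  rw [Set.pair_comm b c]

end Tools

/-! ## The point level -/

section PointStep

variable {R R' : Type u} [CommRing R] [CommRing R'] [IsRegularLocalRing R] [IsRegularLocalRing R']
  (φ : R →+* R') [IsLocalHom φ] (hφm : (maximalIdeal R).map φ ≤ maximalIdeal R')
  (hdim : ringKrullDim R = 3) (hdim' : ringKrullDim R' = 3)

include hφm hdim hdim' in
/-- **S-step-pt (OURS). The point level of the descent down the completed chain.** See the module docstring.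
[cite: CossartJannsenSaito2020, Thm. 13.7 (proof), Prop. 13.5, Lemma 13.4, Lemma 13.6, Thm. 14.4]
[cite: CossartPiltant2008, Lemma 4.5 (2)] -/
theorem completedChain_descent_pointStep (hG : IsGRing R) (hG' : IsGRing R')
    {I : Ideal R} {I' : Ideal R'} {μ : ℕ}
    (hIμ : I ≤ maximalIdeal R ^ μ) (hIne : ¬ I ≤ maximalIdeal R ^ (μ + 1))
    (hIμ' : I' ≤ maximalIdeal R' ^ μ) (hIne' : ¬ I' ≤ maximalIdeal R' ^ (μ + 1))
    (hτ' : ∀ c' : Fin 3 → R', Ideal.span {c' 0, c' 1, c' 2} = maximalIdeal R' → hironakaTauAt c' I' μ = 1)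
    (uN : R) (uN' : R') (isPt' : Prop) (P' : Ideal R')
    (hexc_pt : (maximalIdeal R).map φ = Ideal.span {uN'})
    (hI : I' = (I.map φ).colon {uN' ^ μ})
    (hpt_cases : ∀ (c : Fin 3 → R), Ideal.span {c 0, c 1, c 2} = maximalIdeal R →
      (∀ G ∈ initialForms c I μ, ∃ a : ResidueField R, G = C a * X 0 ^ μ) →
      (Function.Surjective (ResidueField.map φ) ∧
        ∃ (a : R) (y' w' : R'), φ (c 0) = φ (c 1) * y' ∧ φ (c 2 - a * c 1) = φ (c 1) * w' ∧
          Ideal.span {y', φ (c 1), w'} = maximalIdeal R') ∨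
      (¬ Function.Surjective (ResidueField.map φ) ∧
        ∃ (t : R') (Q : Polynomial R) (y' : R'),
          φ (c 0) = φ (c 1) * y' ∧ φ (c 2) = φ (c 1) * t ∧ Q.Monic ∧
          2 ≤ (Q.map (residue R)).natDegree ∧ Irreducible (Q.map (residue R)) ∧
          (∀ G : Polynomial R, Polynomial.eval₂ φ t G ∈ maximalIdeal R' ↔
            Q.map (residue R) ∣ G.map (residue R)) ∧
          (∀ r : ResidueField R', ∃ G : Polynomial R, residue R' (Polynomial.eval₂ φ t G) = r) ∧
          Ideal.span {y', φ (c 1), Polynomial.eval₂ φ t Q} = maximalIdeal R') ∨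
      (Function.Surjective (ResidueField.map φ) ∧
        ∃ (y' v' : R'), φ (c 0) = φ (c 2) * y' ∧ φ (c 1) = φ (c 2) * v' ∧
          Ideal.span {y', v', φ (c 2)} = maximalIdeal R'))
    (hisol : ∀ (𝔮 : Ideal R) [𝔮.IsPrime], 𝔮 ≠ maximalIdeal R →
      ¬ I.map (algebraMap R (Localization.AtPrime 𝔮)) ≤ maximalIdeal (Localization.AtPrime 𝔮) ^ μ)
    (hqis' : ∀ (𝔮 : Ideal R') [𝔮.IsPrime], 𝔮 ≠ maximalIdeal R' → (isPt' ∨ 𝔮 ≠ P') →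
      ¬ I'.map (algebraMap R' (Localization.AtPrime 𝔮)) ≤ maximalIdeal (Localization.AtPrime 𝔮) ^ μ)
    (hPsucc_pt : ¬ isPt' → ∀ (y w : R) (y' : R'), Ideal.span {y, uN, w} = maximalIdeal R →
      (∀ G ∈ initialForms ![y, uN, w] I μ, ∃ a : ResidueField R, G = C a * X 0 ^ μ) →
      φ y = uN' * y' → Ideal.span {y', uN'} = P')
    [IsRegularLocalRing (AdicCompletion (maximalIdeal R) R)] [IsRegularLocalRing (AdicCompletion (maximalIdeal R') R')]
    (x : Fin 3 → AdicCompletion (maximalIdeal R) R) (p₁ p₂ : R) (e : Bool)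
    (hx1 : x 1 = algebraMap R (AdicCompletion (maximalIdeal R) R) p₁)
    (hx2 : x 2 = algebraMap R (AdicCompletion (maximalIdeal R) R) p₂)
    (hgenx : Ideal.span {x 0, x 1, x 2} = maximalIdeal (AdicCompletion (maximalIdeal R) R))
    (hprep : ∀ B, PreparedUpTo x (I.map (algebraMap R (AdicCompletion (maximalIdeal R) R))) μ B)
    (hne : (pts x (I.map (algebraMap R (AdicCompletion (maximalIdeal R) R))) μ).Nonempty)
    (hδ : μ.factorial < deltaS x (I.map (algebraMap R (AdicCompletion (maximalIdeal R) R))) μ)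
    (hflag : Ideal.span {if e then p₂ else p₁} = Ideal.span {uN}) :
    ∃ (x' : Fin 3 → AdicCompletion (maximalIdeal R') R') (p₁' p₂' : R') (e' : Bool),
      x' 1 = algebraMap R' (AdicCompletion (maximalIdeal R') R') p₁' ∧
      x' 2 = algebraMap R' (AdicCompletion (maximalIdeal R') R') p₂' ∧
      Ideal.span {x' 0, x' 1, x' 2} = maximalIdeal (AdicCompletion (maximalIdeal R') R') ∧
      (∀ B, PreparedUpTo x' (I'.map (algebraMap R' (AdicCompletion (maximalIdeal R') R'))) μ B) ∧
      (pts x' (I'.map (algebraMap R' (AdicCompletion (maximalIdeal R') R'))) μ).Nonempty ∧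
      μ.factorial < deltaS x' (I'.map (algebraMap R' (AdicCompletion (maximalIdeal R') R'))) μ ∧
      Ideal.span {if e' then p₂' else p₁'} = Ideal.span {uN'} ∧
      (¬ isPt' → ∃ y₁ ∈ maximalIdeal R', Ideal.span {y₁, uN'} = P') ∧
      2 * betaS x' (I'.map (algebraMap R' (AdicCompletion (maximalIdeal R') R'))) μ + (if e' then 1 else 0) ≤
        2 * betaS x (I.map (algebraMap R (AdicCompletion (maximalIdeal R) R))) μ + (if e then 1 else 0) ∧
      (2 * betaS x' (I'.map (algebraMap R' (AdicCompletion (maximalIdeal R') R'))) μ + (if e' then 1 else 0) =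
          2 * betaS x (I.map (algebraMap R (AdicCompletion (maximalIdeal R) R))) μ + (if e then 1 else 0) →
        Function.Surjective (ResidueField.map φ) ∧ Ideal.span {uN'} = Ideal.span {φ uN}) := by
  classical
  have hL := Nat.factorial_pos μ
  haveI : IsDomain R := isDomain_of_isRegularLocalRing R
  haveI : IsDomain R' := isDomain_of_isRegularLocalRing R'
  have hdimA : ringKrullDim (AdicCompletion (maximalIdeal R) R) = 3 := by rw [ringKrullDim_adicCompletion, hdim]
  have hdimB : ringKrullDim (AdicCompletion (maximalIdeal R') R') = 3 := by rw [ringKrullDim_adicCompletion, hdim']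
  have hIμA : I.map (algebraMap R (AdicCompletion (maximalIdeal R) R)) ≤
      maximalIdeal (AdicCompletion (maximalIdeal R) R) ^ μ := map_le_pow_maximalIdeal_adicCompletion hIμ
  have hIneA : ¬ I.map (algebraMap R (AdicCompletion (maximalIdeal R) R)) ≤
      maximalIdeal (AdicCompletion (maximalIdeal R) R) ^ (μ + 1) := not_map_le_pow_maximalIdeal_adicCompletion hIne
  have hIμB : I'.map (algebraMap R' (AdicCompletion (maximalIdeal R') R')) ≤
      maximalIdeal (AdicCompletion (maximalIdeal R') R') ^ μ := map_le_pow_maximalIdeal_adicCompletion hIμ'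
  -- (0) the algebraic label `(l, p₁, p₂)` under `x`, adapted
  obtain ⟨l, -, hgenR, hadR⟩ := exists_adapted_label_of_completion hdim hIμ x p₁ p₂ hx1 hx2 hgenx hδ
  have hgenR' : Ideal.span {(![l, p₁, p₂] : Fin 3 → R) 0, (![l, p₁, p₂] : Fin 3 → R) 1, (![l, p₁, p₂] : Fin 3 → R) 2} =
      maximalIdeal R := by simpa using hgenR
  -- the label `(l, u_n, po)` for `hPsucc_pt` (`po` = the non-flagged slot)
  obtain ⟨po, hgenU⟩ : ∃ po : R, Ideal.span {l, uN, po} = maximalIdeal R := by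
    cases e
    · have hf : Ideal.span {p₁} = Ideal.span {uN} := by simpa using hflag
      exact ⟨p₂, by rw [← span_triple_eq_of_span_singleton_eq l p₂ hf]; exact hgenR⟩
    · have hf : Ideal.span {p₂} = Ideal.span {uN} := by simpa using hflag
      exact ⟨p₁, by rw [← span_triple_eq_of_span_singleton_eq l p₁ hf, span_triple_swap23]; exact hgenR⟩
  have hadU : ∀ G ∈ initialForms ![l, uN, po] I μ, ∃ a : ResidueField R, G = C a * X 0 ^ μ :=
    forall_initialForms_of_eq_zero (![l, p₁, p₂]) hdim hIμ (![l, uN, po]) hgenR hgenU rfl hadR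
  -- the next centre's presentation, once `𝔪 R′ = (g)` with `φ l = g · y′`
  have hpres_of : ∀ (g y' : R'), Ideal.span {uN'} = Ideal.span {g} → φ l = g * y' → y' ∈ maximalIdeal R' →
      ∃ y₁ ∈ maximalIdeal R', (¬ isPt' → Ideal.span {y₁, uN'} = P') ∧ Ideal.span {y₁} = Ideal.span {y'} := by
    intro g y' hug hl hy'
    obtain ⟨ε, hε⟩ := Ideal.span_singleton_eq_span_singleton.mp hug
    have hy₁m : (ε : R') * y' ∈ maximalIdeal R' := Ideal.mul_mem_left (maximalIdeal R') (ε : R') hy'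
    have hy₁s : Ideal.span {(ε : R') * y'} = Ideal.span {y'} := Ideal.span_singleton_mul_left_unit ε.isUnit y'
    have hl₁ : φ l = uN' * ((ε : R') * y') := by rw [← mul_assoc, hε]; exact hl
    have hP₁ : ¬ isPt' → Ideal.span {(ε : R') * y', uN'} = P' := fun hnp =>
      hPsucc_pt hnp l po ((ε : R') * y') hgenU hadU hl₁
    exact ⟨(ε : R') * y', hy₁m, hP₁, hy₁s⟩
  -- quasi-isolation at the point level: `α(x) < L` in `R̂` (B1)
  have hαx : alphaS x (I.map (algebraMap R (AdicCompletion (maximalIdeal R) R))) μ < μ.factorial :=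
    (pts_nonempty_and_alphaS_lt_of_isolated x hgenx hdimA
      (fun 𝔓 _ h𝔓 => isolated_map_adicCompletion hG hisol 𝔓 h𝔓)).2
  -- the measure bookkeeping: `[e] ≤ 1`
  have he1 : (if e then 1 else 0 : ℕ) ≤ 1 := by split <;> omega
  -- the trichotomy on `(l, p₁, p₂)`
  rcases hpt_cases ![l, p₁, p₂] hgenR' hadR with ⟨hsurj, a, y', w', h0, h2, hgen'⟩ | ⟨hns, t, Q, y', h0, h2, -, -, -, -, -, hgen'⟩ |
    ⟨hsurj, y', v', h0, h1, hgen'⟩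
  · ---------------------------------------------------------------- (i) rational point of the `p₁`-chart
    simp only [Matrix.cons_val_zero, Matrix.cons_val_one, Matrix.cons_val_two, Matrix.tail_cons,
      Matrix.head_cons] at h0 h2 hgen'
    have hm : (maximalIdeal R).map φ = Ideal.span {φ p₁} := by
      have := map_maximalIdeal_eq_span_of_ratBlock φ (c := ![l, p₁, p₂]) hgenR' (a := a) (y' := y') (w' := w')
        (by simpa using h0) (by simpa using h2)
      simpa using this
    have huN' : Ideal.span {uN'} = Ideal.span {φ p₁} := hexc_pt.symm.trans hm
    have hI₁ : I' = (I.map φ).colon {φ p₁ ^ μ} := hI.trans (colon_singleton_pow_eq_of_span_singleton_eq _ huN' μ)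
    have hy'm : y' ∈ maximalIdeal R' := hgen' ▸ Ideal.subset_span (by simp)
    -- shear by `a` (R-4), then the `p₁`-chart point step (B5-pt)
    obtain ⟨xs, hxs1, hxs2, hgens, hpreps, hnes, hδs, -, -, hβs⟩ :=
      completedChain_shear x hgenx hdimA hIμA hIneA hne hδ hprep (algebraMap R (AdicCompletion (maximalIdeal R) R) a)
    have hxs1' : xs 1 = algebraMap R (AdicCompletion (maximalIdeal R) R) p₁ := by rw [hxs1, hx1]
    have hxs2' : xs 2 = algebraMap R (AdicCompletion (maximalIdeal R) R) (p₂ - a * p₁) := by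
      rw [hxs2, hx1, hx2, map_sub, map_mul]
    have hw : xs 2 - algebraMap R (AdicCompletion (maximalIdeal R) R) (p₂ - a * p₁) ∈
        maximalIdeal (AdicCompletion (maximalIdeal R) R) ^ 2 := by
      rw [hxs2', sub_self]; exact Ideal.zero_mem _
    obtain ⟨x', hx'1, hgen'x, h₀, h₂, hprep', hne', hδ', -, happ'⟩ :=
      completedChain_point_step φ hφm hdim hdim' hsurj p₁ hIμ hIne hIμ' hIne' hI₁ hτ'
        (hpoint_of_pointCases φ hdim' hpt_cases p₁ hm hsurj) xs hxs1' hgens hpreps hnes hδs (p₂ - a * p₁) hw w' h2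
        ⟨y', hgen'⟩
    -- the new third slot is exactly `ι′ w′`
    have hx'2 : x' 2 = algebraMap R' (AdicCompletion (maximalIdeal R') R') w' :=
      eq_of_forall_sub_mem_pow_maximalIdeal fun k => happ' (p₂ - a * p₁) w' k h2 (by
        rw [hxs2', sub_self]; exact Ideal.zero_mem _)
    -- the laws: `β′ ≤ β`
    obtain ⟨-, -, hβle⟩ := completedChain_pointStep_laws φ hφm hdim hdim' p₁ hIμ hI₁ xs hxs1' hgens hnes hδs x' hx'1
      hgen'x h₀ h₂
    obtain ⟨y₁, hy₁m, hy₁P, -⟩ := hpres_of (φ p₁) y' huN' h0 hy'm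
    refine ⟨x', φ p₁, w', false, hx'1, hx'2, hgen'x, hprep', hne', hδ', by simpa using huN'.symm,
      fun hnp => ⟨y₁, hy₁m, hy₁P hnp⟩,
      ?_, fun heq => ⟨hsurj, ?_⟩⟩
    · simp only [Bool.false_eq_true, if_false, add_zero]
      rw [hβs] at hβle; omega
    · -- equality forces `e = 1`, and then `(u_{n+1}) = (φ p₁) = (φ u_n)`
      cases e
      · have hf : Ideal.span {p₁} = Ideal.span {uN} := by simpa using hflag
        rw [huN', ← map_span_singleton', hf, map_span_singleton']
      · exfalso
        simp only [Bool.false_eq_true, if_false, add_zero, if_true] at heq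
        omega
  · ---------------------------------------------------------------- (iii) non-rational point of the `p₁`-chart
    simp only [Matrix.cons_val_zero, Matrix.cons_val_one, Matrix.cons_val_two, Matrix.tail_cons,
      Matrix.head_cons] at h0 h2 hgen'
    have hm : (maximalIdeal R).map φ = Ideal.span {φ p₁} := by
      have := map_maximalIdeal_eq_span_of_nonRatBlock φ (c := ![l, p₁, p₂]) hgenR' (y' := y') (t := t)
        (by simpa using h0) (by simpa using h2)
      simpa using this
    have huN' : Ideal.span {uN'} = Ideal.span {φ p₁} := hexc_pt.symm.trans hm
    have hI₁ : I' = (I.map φ).colon {φ p₁ ^ μ} := hI.trans (colon_singleton_pow_eq_of_span_singleton_eq _ huN' μ)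
    have hy'm : y' ∈ maximalIdeal R' := hgen' ▸ Ideal.subset_span (by simp)
    obtain ⟨y₁, hy₁m, hy₁P, hy₁s⟩ := hpres_of (φ p₁) y' huN' h0 hy'm
    -- no permissible formal surface at level `n + 1` (R-3b), from quasi-isolation there
    have hNS' : ∀ c' : Fin 3 → (AdicCompletion (maximalIdeal R') R'),
        Ideal.span {c' 0, c' 1, c' 2} = maximalIdeal (AdicCompletion (maximalIdeal R') R') →
        ¬ I'.map (algebraMap R' (AdicCompletion (maximalIdeal R') R')) ≤ Ideal.span {c' 0 ^ μ} := by
      refine not_map_adicCompletion_le_span_pow hG' hdim' (fun 𝔮 _ h𝔮 hno => hqis' 𝔮 h𝔮 ?_)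
      by_cases hp : isPt'
      · exact Or.inl hp
      · refine Or.inr fun heq => ?_
        subst heq
        -- `P′ = (y₁, u_{n+1})` contains two members of the regular system `(y₁, u_{n+1}, Q(t))`
        have hrs : Ideal.span {y₁, uN', Polynomial.eval₂ φ t Q} = maximalIdeal R' := by
          rw [span_triple_eq_of_span_singleton_eq y₁ (Polynomial.eval₂ φ t Q) huN', Ideal.span_insert, hy₁s,
            ← Ideal.span_insert]
          exact hgen'
        have hP := hy₁P hp
        exact hno y₁ uN' (Polynomial.eval₂ φ t Q) hrs (hP ▸ Ideal.subset_span (by simp))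
          (hP ▸ Ideal.subset_span (by simp))
    obtain ⟨x', Q₃, hx'1, hgen'x, hprep', hne', hδ', -, hβlt, happ'⟩ :=
      completedChain_nonRational_step φ hφm hdim hdim' p₁ hIμ hIne hIμ' hIne' hI₁ hτ'
        (hnonrat_of_pointCases φ hpt_cases p₁ hns) x hx1 hgenx hprep hne hδ hαx hNS' p₂
        (by rw [hx2, sub_self]; exact Ideal.zero_mem _)
    have hx'2 : x' 2 = algebraMap R' (AdicCompletion (maximalIdeal R') R') (Polynomial.eval t Q₃) :=
      eq_of_forall_sub_mem_pow_maximalIdeal fun k => happ' p₂ t k h2 (by rw [hx2, sub_self]; exact Ideal.zero_mem _)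
    refine ⟨x', φ p₁, Polynomial.eval t Q₃, false, hx'1, hx'2, hgen'x, hprep', hne', hδ', by simpa using huN'.symm,
      fun hnp => ⟨y₁, hy₁m, hy₁P hnp⟩, ?_, fun heq => ?_⟩
    · simp only [Bool.false_eq_true, if_false, add_zero]; omega
    · exfalso
      simp only [Bool.false_eq_true, if_false, add_zero] at heq; omega
  · ---------------------------------------------------------------- (i′) the origin of the `p₂`-chart
    simp only [Matrix.cons_val_zero, Matrix.cons_val_one, Matrix.cons_val_two, Matrix.tail_cons,
      Matrix.head_cons] at h0 h1 hgen'
    have hm : (maximalIdeal R).map φ = Ideal.span {φ p₂} := by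
      have := map_maximalIdeal_eq_span_of_oppBlock φ (c := ![l, p₁, p₂]) hgenR' (y' := y') (v' := v')
        (by simpa using h0) (by simpa using h1)
      simpa using this
    have huN' : Ideal.span {uN'} = Ideal.span {φ p₂} := hexc_pt.symm.trans hm
    have hI₂ : I' = (I.map φ).colon {φ p₂ ^ μ} := hI.trans (colon_singleton_pow_eq_of_span_singleton_eq _ huN' μ)
    have hy'm : y' ∈ maximalIdeal R' := hgen' ▸ Ideal.subset_span (by simp)
    obtain ⟨y₁, hy₁m, hy₁P, -⟩ := hpres_of (φ p₂) y' huN' h0 hy'm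
    -- the swapped label `(ŷ, ι p₂, ι p₁)`
    set xs : Fin 3 → AdicCompletion (maximalIdeal R) R := x ∘ σ₁₂ with hxsdef
    have hxs0 : xs 0 = x 0 := by simp [hxsdef]
    have hxs1 : xs 1 = algebraMap R (AdicCompletion (maximalIdeal R) R) p₂ := by simp [hxsdef, hx2]
    have hxs2 : xs 2 = algebraMap R (AdicCompletion (maximalIdeal R) R) p₁ := by simp [hxsdef, hx1]
    have hgens : Ideal.span {xs 0, xs 1, xs 2} = maximalIdeal (AdicCompletion (maximalIdeal R) R) := by
      rw [hxsdef, span_triple_comp_σ₁₂]; exact hgenx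
    have hpreps : ∀ B, PreparedUpTo xs (I.map (algebraMap R (AdicCompletion (maximalIdeal R) R))) μ B :=
      preparedUpTo_forall_comp_σ₁₂ x hgenx hdimA hprep
    have hnes : (pts xs (I.map (algebraMap R (AdicCompletion (maximalIdeal R) R))) μ).Nonempty :=
      (pts_comp_σ₁₂_nonempty_iff x _ μ).mpr hne
    have hδs : μ.factorial < deltaS xs (I.map (algebraMap R (AdicCompletion (maximalIdeal R) R))) μ := by
      rw [hxsdef, deltaS_comp_σ₁₂]; exact hδ
    have hgen'' : Ideal.span {y', φ p₂, v'} = maximalIdeal R' := by rw [span_triple_swap23]; exact hgen'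
    obtain ⟨xs', hxs'1, hgen's, h₀, h₂, hprep's, hne's, hδ's, -, happ'⟩ :=
      completedChain_point_step φ hφm hdim hdim' hsurj p₂ hIμ hIne hIμ' hIne' hI₂ hτ'
        (hpoint_of_pointCases φ hdim' hpt_cases p₂ hm hsurj) xs hxs1 hgens hpreps hnes hδs p₁
        (by rw [hxs2, sub_self]; exact Ideal.zero_mem _) v' h1 ⟨y', hgen''⟩
    have hxs'2 : xs' 2 = algebraMap R' (AdicCompletion (maximalIdeal R') R') v' :=
      eq_of_forall_sub_mem_pow_maximalIdeal fun k => happ' p₁ v' k h1 (by rw [hxs2, sub_self]; exact Ideal.zero_mem _)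
    -- swap back: `x′ = (ŷ′, ι′ v′, ι′ φ p₂)`
    set x' : Fin 3 → AdicCompletion (maximalIdeal R') R' := xs' ∘ σ₁₂ with hx'def
    have hx'0 : x' 0 = xs' 0 := by simp [hx'def]
    have hx'1 : x' 1 = algebraMap R' (AdicCompletion (maximalIdeal R') R') v' := by simp [hx'def, hxs'2]
    have hx'2 : x' 2 = algebraMap R' (AdicCompletion (maximalIdeal R') R') (φ p₂) := by simp [hx'def, hxs'1]
    have hgen'x : Ideal.span {x' 0, x' 1, x' 2} = maximalIdeal (AdicCompletion (maximalIdeal R') R') := by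
      rw [hx'def, span_triple_comp_σ₁₂]; exact hgen's
    have hprep' : ∀ B, PreparedUpTo x' (I'.map (algebraMap R' (AdicCompletion (maximalIdeal R') R'))) μ B :=
      preparedUpTo_forall_comp_σ₁₂ xs' hgen's hdimB hprep's
    have hne' : (pts x' (I'.map (algebraMap R' (AdicCompletion (maximalIdeal R') R'))) μ).Nonempty :=
      (pts_comp_σ₁₂_nonempty_iff xs' _ μ).mpr hne's
    have hδ' : μ.factorial < deltaS x' (I'.map (algebraMap R' (AdicCompletion (maximalIdeal R') R'))) μ := by
      rw [hx'def, deltaS_comp_σ₁₂]; exact hδ's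
    -- the laws in print orientation: `β′ + L ≤ α + β`, `α < L`
    have hJ' := weakTransform_adicCompletion_of_eq φ hφm hI₂
    have hc2 : x' 2 = adicCompletionMap (maximalIdeal R) (maximalIdeal R') φ hφm (x 2) := by
      rw [hx'2, hx2, adicCompletionMap_algebraMap]
    have hc0 : adicCompletionMap (maximalIdeal R) (maximalIdeal R') φ hφm (x 0) =
        adicCompletionMap (maximalIdeal R) (maximalIdeal R') φ hφm (x 2) * x' 0 := by
      rw [← hxs0, hx2, ← hxs1, hx'0]; exact h₀
    have hc1 : adicCompletionMap (maximalIdeal R) (maximalIdeal R') φ hφm (x 1) =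
        adicCompletionMap (maximalIdeal R) (maximalIdeal R') φ hφm (x 2) * x' 1 := by
      have h := h₂
      rw [hxs2, hxs1, ← hx1, ← hx2] at h
      rw [h, hx'def]; simp
    obtain ⟨-, hβ⟩ := completedChain_pointStepTwo_laws φ hφm hdim hdim' hIμA x hgenx hne hδ x' hgen'x hc2 hc0 hc1
    rw [hx2, ← hJ'] at hβ
    refine ⟨x', v', φ p₂, true, hx'1, hx'2, hgen'x, hprep', hne', hδ', by simpa using huN'.symm,
      fun hnp => ⟨y₁, hy₁m, hy₁P hnp⟩, ?_, fun heq => ?_⟩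
    · simp only [if_true]; omega
    · exfalso; simp only [if_true] at heq; omega

end PointStep

end Literature.AlgebraicGeometry.Resolution

end
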